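import Summits.CriticalPhenomena.PercolationContinuityZ3.Theorems.SahiMasterFamilyGluedPureFailures

/-!
# The CROSS lemma for the glued frame field: annihilator points of two distinct non-pure members share two failed pure members

Unit `prim-master-conj` (crux anchor stmt-CriticalPhenomena-4575), gen 12; memo HOME/prim-master-conj/TIGHTNESS-IV.md §5.
Setting `GluedSetting` (glued frames with disjoint supports, structured faces, consistent deletion faces) with a core-free coordinate.  THEOREM:

  **`GluedSetting.two_le_card_cross`**: for members `z₁ ≠ z₂` and configurations `χ₁ ∈ gann z₁`, `χ₂ ∈ gann z₂`, at least two PURE members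
  fail at both `χ₁` and `χ₂`.

(For a structured family this is (α) inside the robust sub-family `failSet(χ₁) + z₂`; census `{0,1}^4`, `k ≤ 6`: 0 exceptions.)  Proof by strong
induction on `|χ₁| + |χ₂|`: removing a coordinate from a violating pair without creating a new doubly-failed pure member gives a smaller violating pair,
so (r1) each `χᵢ` lies inside its member's glued block plus the pure supports.  KEY (`mem_or_mem_of_cross`): every core-free coordinate lies in
`χ₁ ∪ χ₂` — otherwise in the deletion face at it, `χ₁` annihilates `z₁`, every sub-family between its fail set and `W ∖ z₁` is structured with the
restricted frames (T1 + FR), in particular `failSet(χ₁) + z₂`, where (α) for structured families (`exists_two_pure_not_mem`) yields a globally non-pure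
OWNER of the coordinate; the owner owns every vertex of its glued frame; vertex lemma.  Then the vertices of `gframe zᵢ` and of every pure member are
pivotal at `χ₁` or at `χ₂` (induction hypothesis), so all these vertex sets are empty (vertex lemma), and KEY leaves no core-free coordinate.
This is the `s = 2` case of the MULTI-CROSS lemma of TIGHTNESS-IV §5 (the remaining input for all orders).  Pure combinatorics; axioms standard.
[this work]
-/

noncomputable section

open scoped Classical

namespace Summit.CriticalPhenomena.PercolationContinuityZ3.Theorems

namespace GluedFrames

open Finset Function
open Literature.Probability.LatticeModels.Kahn2022 (Affects)

variable {ι : Type*} [Fintype ι] {κ : Type*} {U : κ → Set (Set ι)} {W : Finset κ}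

omit [Fintype ι] in
/-- Removing a non-affecting coordinate that is present does not change membership in an increasing event. [folklore] -/
theorem diff_singleton_mem_iff_of_not_affects {A : Set (Set ι)} (hA : IsUpperSet A) {g : ι} (hg : ¬ Affects A g) {χ : Set ι}
    (hgχ : g ∈ χ) : χ \ {g} ∈ A ↔ χ ∈ A := by
  refine ⟨fun h => ?_, fun h => diff_singleton_mem_of_not_affects hA hg h⟩
  have := (insert_mem_iff_of_not_affects hA hg (χ \ {g})).2 h
  rwa [Set.insert_sdiff_singleton, Set.insert_eq_of_mem hgχ] at this

namespace GluedSetting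

variable (G : GluedSetting U W)
include G

/-- A pure support misses the glued block of a non-pure member. [this work] -/
theorem not_mem_esupp_gframe_of_pure {q : κ} (hq : q ∈ W) (hpq : gann U W q = ∅) {y : κ} (hyN : (gann U W y).Nonempty)
    {g : ι} (hg : g ∈ esupp (U q)) : g ∉ esupp (gframe U W y) := by
  intro hgy
  have hqy : q ≠ y := by rintro rfl; exact hyN.ne_empty hpq
  have := G.hd q hq y (G.hWU y) hqy
  rw [G.gframe_eq_of_pure hpq] at this
  exact Finset.disjoint_left.1 this hg hgy

/-- Pure supports are pairwise disjoint. [this work] -/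
theorem not_mem_esupp_of_pure_ne {q : κ} (hq : q ∈ W) (hpq : gann U W q = ∅) {q' : κ} (hq' : q' ∈ W) (hpq' : gann U W q' = ∅)
    (hne : q ≠ q') {g : ι} (hg : g ∈ esupp (U q)) : g ∉ esupp (U q') := by
  intro hg'
  have := G.hd q hq q' hq' hne
  rw [G.gframe_eq_of_pure hpq, G.gframe_eq_of_pure hpq'] at this
  exact Finset.disjoint_left.1 this hg hg'

/-- **Owner lemma, two-point form.**  If `χ₁ ∈ gann z₁`, `χ₂ ∈ gann z₂` (`z₁ ≠ z₂`), at most one pure member fails at both, and the core-free `f`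
lies in neither, then some globally non-pure member `c ∉ {z₁, z₂}` is pure in the deletion face at `f` (so it OWNS `f`). [this work] -/
theorem exists_owner₂ {z₁ z₂ : κ} (hz : z₁ ≠ z₂) {χ₁ χ₂ : Set ι} (h₁ : χ₁ ∈ gann U W z₁) (h₂ : χ₂ ∈ gann U W z₂)
    (hA : (((W.filter fun p => gann U W p = ∅).filter fun p => χ₁ ∉ U p).filter fun p => χ₂ ∉ U p).card ≤ 1)
    {f : ι} (hf : CoreFree U f) (hf₁ : f ∉ χ₁) (hf₂ : f ∉ χ₂) :
    ∃ c ∈ W, c ≠ z₁ ∧ c ≠ z₂ ∧ (gann U W c).Nonempty ∧ cframe (faceF U f) W c ⊆ faceF U f c := by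
  obtain ⟨hFs, hFc⟩ := G.hF f hf
  set Φ := faceF U f with hΦdef
  have hΦU : ∀ k, IsUpperSet (Φ k) := isUpperSet_faceF U G.hU f
  have hΦne : ∀ k, (Φ k).Nonempty := faceF_nonempty U hf
  have hmemA : ∀ {x : κ} {ω : Set ι}, f ∉ ω → (ω ∈ cframe Φ W x ↔ ω ∈ gframe U W x) := by
    intro x ω hfω; rw [hFc x (G.hWU x), mem_secAt_false_iff_of_notMem hfω]
  have hmemU : ∀ {x : κ} {ω : Set ι}, f ∉ ω → (ω ∈ Φ x ↔ ω ∈ U x) := by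
    intro x ω hfω; rw [hΦdef, faceF_apply, mem_secAt_false_iff_of_notMem hfω]
  -- `χ₁` annihilates `z₁` in the face: the sub-families between its fail set and `W ∖ z₁` are structured, frames restrict
  have hA₁ : χ₁ ∈ cframe Φ W z₁ := (hmemA hf₁).2 h₁.1
  have hU₁ : χ₁ ∉ Φ z₁ := fun h => h₁.2 ((hmemU hf₁).1 h)
  have hN₁ : ¬ (cframe Φ W z₁ ⊆ Φ z₁) := fun h => hU₁ (h hA₁)
  have hWz : Structured Φ (W.erase z₁) := structured_erase_of_not_subset Φ hΦU hΦne hFs (G.hWU z₁) hN₁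
  have hsafe : χ₁ ∈ Safe Φ (W.erase z₁) := annihilator_subset_safe_erase Φ hΦU hΦne hFs (G.hWU z₁) hWz ⟨hA₁, hU₁⟩
  obtain ⟨-, hrob⟩ := (mem_safe Φ).1 hsafe
  set R := insert z₂ (failSet Φ (W.erase z₁) χ₁) with hRdef
  have hRW : R ⊆ W.erase z₁ := by
    intro x hx
    rcases mem_insert.1 hx with rfl | hx
    · exact mem_erase.2 ⟨hz.symm, G.hWU _⟩
    · exact failSet_subset Φ _ χ₁ hx
  have hFR : failSet Φ (W.erase z₁) χ₁ ⊆ R := subset_insert _ _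
  have hR : Structured Φ R := hrob R hFR hRW
  have hfr : ∀ w ∈ R, cframe Φ R w = cframe Φ W w := by
    intro w hw
    rw [cframe_eq_of_robust Φ hΦU hΦne ((W.erase z₁) \ R).card le_rfl hWz hRW
      (fun R' h1 h2 => hrob R' (hFR.trans h1) h2) w hw]
    exact cframe_erase Φ hΦU hΦne hFs hWz (hRW hw)
  -- `χ₂` annihilates `z₂` in the structured sub-family `R`
  have hz₂R : z₂ ∈ R := mem_insert_self _ _
  have hA₂ : χ₂ ∈ cframe Φ R z₂ := by rw [hfr z₂ hz₂R]; exact (hmemA hf₂).2 h₂.1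
  have hU₂ : χ₂ ∉ Φ z₂ := fun h => h₂.2 ((hmemU hf₂).1 h)
  obtain ⟨a, ha, b, hb, hab, haz, hbz, hfa, hfb, hθa, hθb⟩ := exists_two_pure_not_mem Φ hΦU hΦne hR hz₂R hA₂ hU₂
  have hfail₁ : ∀ {x}, x ∈ R → x ≠ z₂ → χ₁ ∉ U x := by
    intro x hx hxz
    rcases mem_insert.1 hx with rfl | hx
    · exact absurd rfl hxz
    · exact fun h => ((mem_failSet Φ).1 hx).2 ((hmemU hf₁).2 h)
  have hχ₂a : χ₂ ∉ U a := fun h => hθa ((hmemU hf₂).2 h)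
  have hχ₂b : χ₂ ∉ U b := fun h => hθb ((hmemU hf₂).2 h)
  -- not both `a` and `b` are globally pure (at most one pure member fails at both points)
  have hnot : ¬ (gann U W a = ∅ ∧ gann U W b = ∅) := by
    rintro ⟨hpa, hpb⟩
    have hsub : ({a, b} : Finset κ) ⊆
        (((W.filter fun p => gann U W p = ∅).filter fun p => χ₁ ∉ U p).filter fun p => χ₂ ∉ U p) := by
      intro c hc
      simp only [mem_filter]
      rcases mem_insert.1 hc with rfl | hc
      · exact ⟨⟨⟨G.hWU _, hpa⟩, hfail₁ ha haz⟩, hχ₂a⟩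
      · rw [mem_singleton] at hc; subst hc; exact ⟨⟨⟨G.hWU _, hpb⟩, hfail₁ hb hbz⟩, hχ₂b⟩
    have := (card_le_card hsub).trans hA
    rw [card_pair hab] at this
    omega
  have hne₁ : ∀ {x}, x ∈ R → x ≠ z₁ := fun hx => ne_of_mem_erase (hRW hx)
  by_cases hpa : gann U W a = ∅
  · refine ⟨b, G.hWU b, hne₁ hb, hbz, Set.nonempty_iff_ne_empty.2 fun h => hnot ⟨hpa, h⟩, ?_⟩
    rw [← hfr b hb]; exact hfb.le
  · refine ⟨a, G.hWU a, hne₁ ha, haz, Set.nonempty_iff_ne_empty.2 hpa, ?_⟩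
    rw [← hfr a ha]; exact hfa.le

/-- **KEY for the cross lemma**: if `χ₁ ∈ gann z₁` and `χ₂ ∈ gann z₂` (`z₁ ≠ z₂`) lie inside their member's glued block plus the pure supports and at
most one pure member fails at both, then every core-free coordinate lies in `χ₁ ∪ χ₂`. [this work] -/
theorem mem_or_mem_of_cross {z₁ z₂ : κ} (hz : z₁ ≠ z₂) {χ₁ χ₂ : Set ι} (h₁ : χ₁ ∈ gann U W z₁) (h₂ : χ₂ ∈ gann U W z₂)
    (hT₁ : χ₁ ⊆ ↑(esupp (gframe U W z₁)) ∪ ⋃ q ∈ W.filter (fun p => gann U W p = ∅), (↑(esupp (U q)) : Set ι))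
    (hT₂ : χ₂ ⊆ ↑(esupp (gframe U W z₂)) ∪ ⋃ q ∈ W.filter (fun p => gann U W p = ∅), (↑(esupp (U q)) : Set ι))
    (hA : (((W.filter fun p => gann U W p = ∅).filter fun p => χ₁ ∉ U p).filter fun p => χ₂ ∉ U p).card ≤ 1)
    {f : ι} (hf : CoreFree U f) : f ∈ χ₁ ∨ f ∈ χ₂ := by
  by_contra hnot
  rw [not_or] at hnot
  obtain ⟨c, hc, hc₁, hc₂, hcN, hcpure⟩ := G.exists_owner₂ hz h₁ h₂ hA hf hnot.1 hnot.2
  have hfc : f ∈ esupp (gframe U W c) := mem_esupp_of_pure_in_faceF U W G.hU (G.hF f hf).2 hc hcpure hcN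
  -- the glued block of `c` misses both `χ₁` and `χ₂`
  have key : ∀ {z : κ} {χ : Set ι}, c ≠ z →
      χ ⊆ ↑(esupp (gframe U W z)) ∪ ⋃ q ∈ W.filter (fun p => gann U W p = ∅), (↑(esupp (U q)) : Set ι) →
      ∀ g ∈ esupp (gframe U W c), g ∉ χ := by
    intro z χ hcz hχ g hg hgχ
    rcases hχ hgχ with h | h
    · exact Finset.disjoint_left.1 (G.hd c hc z (G.hWU z) hcz) hg (mem_coe.1 h)
    · rw [Set.mem_iUnion₂] at h
      obtain ⟨q, hq, hgq⟩ := h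
      rw [mem_filter] at hq
      exact G.not_mem_esupp_gframe_of_pure hq.1 hq.2 hcN (mem_coe.1 hgq) hg
  have hV : ∀ ψ ∈ gann U W c, ↑(verts (gframe U W c)) ⊆ ψ := by
    intro ψ hψ g hg
    obtain ⟨hgcf, hgc⟩ := G.mem_verts_gframe_iff.1 (mem_coe.1 hg)
    obtain ⟨c', hc', -, -, hc'N, hc'pure⟩ :=
      G.exists_owner₂ hz h₁ h₂ hA hgcf (key hc₁ hT₁ g hgc) (key hc₂ hT₂ g hgc)
    have hgc' : g ∈ esupp (gframe U W c') := mem_esupp_of_pure_in_faceF U W G.hU (G.hF g hgcf).2 hc' hc'pure hc'N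
    have hcc' : c' = c := by
      by_contra hne'
      exact Finset.disjoint_left.1 (G.hd c' hc' c hc hne') hgc' hgc
    subst hcc'
    exact forall_mem_of_pure_in_faceF U W (G.hF g hgcf).2 hc' hc'pure hψ
  have hempty := verts_eq_empty_of_downClosed (isUpperSet_gframe U W G.hU c) (fun ψ hψ => hψ.1) hcN
    (fun ψ hψ ψ' hle hψ' => mem_gann_of_subset U W G.hU hψ hle hψ') hV
  have : f ∈ verts (gframe U W c) := mem_verts_gframe_of_coreFree U W G.hU hf hfc
  rw [hempty] at this
  exact notMem_empty f this

/-- **The inductive step of the cross lemma.**  A violating pair (`χ₁ ∈ gann z₁`, `χ₂ ∈ gann z₂`, at most one pure member failing at both) such that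
no single coordinate can be removed from `χ₁` or from `χ₂` without creating a new doubly-failed pure member (these are the induction hypotheses,
stated as implications to `False`) does not exist. [this work] -/
theorem cross_step (hE0 : ∃ f, CoreFree U f) {z₁ z₂ : κ} (hz : z₁ ≠ z₂) {χ₁ χ₂ : Set ι} (h₁ : χ₁ ∈ gann U W z₁)
    (h₂ : χ₂ ∈ gann U W z₂)
    (hA : (((W.filter fun p => gann U W p = ∅).filter fun p => χ₁ ∉ U p).filter fun p => χ₂ ∉ U p).card ≤ 1)
    (IH₁ : ∀ g ∈ χ₁, χ₁ \ {g} ∈ gann U W z₁ → (∀ q ∈ W, gann U W q = ∅ → χ₁ \ {g} ∉ U q → χ₂ ∉ U q → χ₁ ∉ U q) → False)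
    (IH₂ : ∀ g ∈ χ₂, χ₂ \ {g} ∈ gann U W z₂ → (∀ q ∈ W, gann U W q = ∅ → χ₂ \ {g} ∉ U q → χ₁ ∉ U q → χ₂ ∉ U q) → False) :
    False := by
  have hU := G.hU
  have hz₁N : (gann U W z₁).Nonempty := ⟨_, h₁⟩
  have hz₂N : (gann U W z₂).Nonempty := ⟨_, h₂⟩
  set SP : Set ι := ⋃ q ∈ W.filter (fun p => gann U W p = ∅), (↑(esupp (U q)) : Set ι) with hSPdef
  -- (r1): each configuration lies inside its member's glued block plus the pure supports (else remove the stray coordinate)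
  have hT : ∀ {z z' : κ} {χ χ' : Set ι}, χ ∈ gann U W z →
      (∀ g ∈ χ, χ \ {g} ∈ gann U W z → (∀ q ∈ W, gann U W q = ∅ → χ \ {g} ∉ U q → χ' ∉ U q → χ ∉ U q) → False) →
      χ ⊆ ↑(esupp (gframe U W z)) ∪ SP := by
    intro z z' χ χ' hχ hIH g hg
    by_contra hgT
    rw [Set.mem_union, not_or] at hgT
    refine hIH g hg ⟨diff_singleton_mem_of_not_affects (isUpperSet_gframe U W hU z)
      (fun ha => hgT.1 (mem_coe.2 (mem_esupp.2 ha))) hχ.1, fun h => hχ.2 (hU z Set.sdiff_subset h)⟩ fun q hq hpq hn _ => ?_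
    have hgq : ¬ Affects (U q) g := fun ha =>
      hgT.2 (Set.mem_biUnion (mem_filter.2 ⟨hq, hpq⟩) (mem_coe.2 (mem_esupp.2 ha)))
    exact fun h => hn ((diff_singleton_mem_iff_of_not_affects (hU q) hgq hg).2 h)
  have hT₁ : χ₁ ⊆ ↑(esupp (gframe U W z₁)) ∪ SP := hT (z' := z₂) h₁ IH₁
  have hT₂ : χ₂ ⊆ ↑(esupp (gframe U W z₂)) ∪ SP := hT (z' := z₁) h₂ IH₂
  have hA' : (((W.filter fun p => gann U W p = ∅).filter fun p => χ₂ ∉ U p).filter fun p => χ₁ ∉ U p).card ≤ 1 := by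
    rw [filter_filter, filter_filter] at hA ⊢
    convert hA using 3 with p
    exact and_congr_right fun _ => and_comm
  have KEY : ∀ f, CoreFree U f → f ∈ χ₁ ∨ f ∈ χ₂ := fun f hf => G.mem_or_mem_of_cross hz h₁ h₂ hT₁ hT₂ hA hf
  -- a core-free coordinate in the pure support or in the block of `z'` is not in `χ` (for `χ ⊆ block z ∪ SP`): bookkeeping
  have hnotin : ∀ {z : κ} {χ : Set ι}, χ ⊆ ↑(esupp (gframe U W z)) ∪ SP → ∀ {f : ι}, f ∉ esupp (gframe U W z) →
      (∀ q ∈ W, gann U W q = ∅ → f ∉ esupp (U q)) → f ∉ χ := by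
    intro z χ hχ f hfz hfP hfχ
    rcases hχ hfχ with h | h
    · exact hfz (mem_coe.1 h)
    · rw [Set.mem_iUnion₂] at h
      obtain ⟨q, hq, hfq⟩ := h
      rw [mem_filter] at hq
      exact hfP q hq.1 hq.2 (mem_coe.1 hfq)
  -- (i) the glued frames of `z₁` and `z₂` have no vertex
  have hVz : ∀ {z z' : κ} {χ χ' : Set ι}, z ≠ z' → χ ∈ gann U W z → (gann U W z').Nonempty →
      χ' ⊆ ↑(esupp (gframe U W z')) ∪ SP → (∀ f, CoreFree U f → f ∈ χ ∨ f ∈ χ') →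
      (∀ g ∈ χ, χ \ {g} ∈ gann U W z → (∀ q ∈ W, gann U W q = ∅ → χ \ {g} ∉ U q → χ' ∉ U q → χ ∉ U q) → False) →
      verts (gframe U W z) = ∅ := by
    intro z z' χ χ' hzz' hχ hz'N hχ'T hKEY hIH
    have hin : ∀ f ∈ verts (gframe U W z), f ∈ χ := by
      intro f hf
      obtain ⟨hfcf, hfz⟩ := G.mem_verts_gframe_iff.1 hf
      rcases hKEY f hfcf with h | h
      · exact h
      · exact absurd h (hnotin hχ'T (fun h' => Finset.disjoint_left.1 (G.hd z (G.hWU z) z' (G.hWU z') hzz') hfz h')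
          (fun q hq hpq hfq => G.not_mem_esupp_gframe_of_pure hq hpq ⟨_, hχ⟩ hfq hfz))
    refine verts_eq_empty_of_pivotal (isUpperSet_gframe U W hU z) hχ.1 (fun f hf => hin f (mem_coe.1 hf)) (fun f hf hmem => ?_)
    obtain ⟨-, hfz⟩ := G.mem_verts_gframe_iff.1 hf
    refine hIH f (hin f hf) ⟨hmem, fun h => hχ.2 (hU z Set.sdiff_subset h)⟩ fun q hq hpq hn _ h => hn ?_
    have hfq : ¬ Affects (U q) f := fun ha => G.not_mem_esupp_gframe_of_pure hq hpq ⟨_, hχ⟩ (mem_esupp.2 ha) hfz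
    exact (diff_singleton_mem_iff_of_not_affects (hU q) hfq (hin f hf)).2 h
  have hV₁ : verts (gframe U W z₁) = ∅ := hVz hz h₁ hz₂N hT₂ KEY IH₁
  have hV₂ : verts (gframe U W z₂) = ∅ := hVz hz.symm h₂ hz₁N hT₁ (fun f hf => (KEY f hf).symm) IH₂
  -- (ii) every pure member has no vertex
  have hVq : ∀ q ∈ W, gann U W q = ∅ → verts (U q) = ∅ := by
    intro q hq hpq
    -- removing a vertex `f ∈ χ` of `U q` from `χ`: only the status of `q` can change
    have hmove : ∀ {z z' : κ} {χ χ' : Set ι}, χ ∈ gann U W z →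
        (∀ g ∈ χ, χ \ {g} ∈ gann U W z → (∀ q' ∈ W, gann U W q' = ∅ → χ \ {g} ∉ U q' → χ' ∉ U q' → χ ∉ U q') → False) →
        ∀ f ∈ verts (U q), f ∈ χ → (χ ∈ U q ∧ χ \ {f} ∉ U q ∧ χ' ∉ U q) := by
      intro z z' χ χ' hχ hIH f hf hfχ
      have hfq : f ∈ esupp (U q) := (mem_verts.1 hf).1
      have hrem : χ \ {f} ∈ gann U W z :=
        ⟨diff_singleton_mem_of_not_affects (isUpperSet_gframe U W hU z)
          (fun ha => G.not_mem_esupp_gframe_of_pure hq hpq ⟨_, hχ⟩ hfq (mem_esupp.2 ha)) hχ.1, fun h => hχ.2 (hU z Set.sdiff_subset h)⟩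
      have hother : ∀ q' ∈ W, gann U W q' = ∅ → q' ≠ q → (χ \ {f} ∈ U q' ↔ χ ∈ U q') := by
        intro q' hq' hpq' hne'
        exact diff_singleton_mem_iff_of_not_affects (hU q')
          (fun ha => G.not_mem_esupp_of_pure_ne hq hpq hq' hpq' (Ne.symm hne') hfq (mem_esupp.2 ha)) hfχ
      by_contra hno
      refine hIH f hfχ hrem fun q' hq' hpq' hn hχ' hχq' => ?_
      by_cases hqq' : q' = q
      · subst hqq'; exact hno ⟨hχq', hn, hχ'⟩
      · exact hn ((hother q' hq' hpq' hqq').2 hχq')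
    have hs₁ := fun f hf hfχ => hmove (z' := z₂) h₁ IH₁ f hf hfχ
    have hs₂ := fun f hf hfχ => hmove (z' := z₁) h₂ IH₂ f hf hfχ
    have hverts_cf : ∀ f ∈ verts (U q), CoreFree U f := fun f hf =>
      ((G.mem_verts_gframe_iff (w := q)).1 (by rw [G.gframe_eq_of_pure hpq]; exact hf)).1
    by_cases hχ₁q : χ₁ ∈ U q
    · -- every vertex lies in `χ₁` (one in `χ₂` would force `χ₁ ∉ U q`) and is pivotal there
      have hin : ∀ f ∈ verts (U q), f ∈ χ₁ := by
        intro f hf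
        rcases KEY f (hverts_cf f hf) with h | h
        · exact h
        · exact absurd hχ₁q (hs₂ f hf h).2.2
      exact verts_eq_empty_of_pivotal (hU q) hχ₁q (fun f hf => hin f (mem_coe.1 hf)) fun f hf => (hs₁ f hf (hin f hf)).2.1
    · -- `χ₁ ∉ U q`: no vertex lies in `χ₁`; so all lie in `χ₂`, `χ₂ ∈ U q`, and they are pivotal there
      have hin : ∀ f ∈ verts (U q), f ∈ χ₂ := by
        intro f hf
        rcases KEY f (hverts_cf f hf) with h | h
        · exact absurd (hs₁ f hf h).1 hχ₁q
        · exact h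
      by_cases hne : verts (U q) = ∅
      · exact hne
      · obtain ⟨f₀, hf₀⟩ := Finset.nonempty_iff_ne_empty.2 hne
        have hχ₂q : χ₂ ∈ U q := (hs₂ f₀ hf₀ (hin f₀ hf₀)).1
        exact verts_eq_empty_of_pivotal (hU q) hχ₂q (fun f hf => hin f (mem_coe.1 hf)) fun f hf => (hs₂ f hf (hin f hf)).2.1
  -- (iii) no room for a core-free coordinate
  obtain ⟨f₀, hf₀⟩ := hE0
  have hf₀χ : f₀ ∈ χ₁ ∪ χ₂ := by rcases KEY f₀ hf₀ with h | h; exacts [Or.inl h, Or.inr h]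
  have hcase : ∀ {z : κ} {χ : Set ι}, χ ⊆ ↑(esupp (gframe U W z)) ∪ SP → verts (gframe U W z) = ∅ → f₀ ∉ χ := by
    intro z χ hχT hVz' hf₀χ
    rcases hχT hf₀χ with h | h
    · have := mem_verts_gframe_of_coreFree U W hU hf₀ (mem_coe.1 h)
      rw [hVz'] at this; exact notMem_empty _ this
    · rw [Set.mem_iUnion₂] at h
      obtain ⟨q, hq, hfq⟩ := h
      rw [mem_filter] at hq
      have : f₀ ∈ verts (U q) := mem_verts.2 ⟨mem_coe.1 hfq, hf₀ q⟩
      rw [hVq q hq.1 hq.2] at this; exact notMem_empty _ this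
  rcases hf₀χ with h | h
  · exact hcase hT₁ hV₁ h
  · exact hcase hT₂ hV₂ h

/-- **THE CROSS LEMMA (glued frame field, every order).**  For `χ₁ ∈ gann z₁`, `χ₂ ∈ gann z₂` with `z₁ ≠ z₂`, at least two pure members fail at both
configurations — provided some coordinate is core-free. [this work] -/
theorem two_le_card_cross (hE0 : ∃ f, CoreFree U f) {z₁ z₂ : κ} (hz : z₁ ≠ z₂) :
    ∀ (n : ℕ) {χ₁ χ₂ : Set ι}, χ₁.ncard + χ₂.ncard ≤ n → χ₁ ∈ gann U W z₁ → χ₂ ∈ gann U W z₂ →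
      2 ≤ ((((W.filter fun p => gann U W p = ∅).filter fun p => χ₁ ∉ U p).filter fun p => χ₂ ∉ U p)).card := by
  intro n
  induction n with
  | zero =>
    intro χ₁ χ₂ hn h₁ h₂
    by_contra hlt
    push Not at hlt
    refine G.cross_step hE0 hz h₁ h₂ (by omega) (fun g hg => ?_) (fun g hg => ?_)
    · have : χ₁.ncard = 0 := by omega
      rw [Set.ncard_eq_zero (Set.toFinite χ₁)] at this
      exact absurd hg (this ▸ Set.notMem_empty g)
    · have : χ₂.ncard = 0 := by omega
      rw [Set.ncard_eq_zero (Set.toFinite χ₂)] at this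
      exact absurd hg (this ▸ Set.notMem_empty g)
  | succ n ih =>
    intro χ₁ χ₂ hn h₁ h₂
    by_contra hlt
    push Not at hlt
    refine G.cross_step hE0 hz h₁ h₂ (by omega) (fun g hg h₁' hP => ?_) (fun g hg h₂' hP => ?_)
    · have hcard : (χ₁ \ {g}).ncard + χ₂.ncard ≤ n := by
        have := Set.ncard_sdiff_singleton_add_one hg (Set.toFinite χ₁); omega
      have h2 := ih hcard h₁' h₂
      have hsub : (((W.filter fun p => gann U W p = ∅).filter fun p => χ₁ \ {g} ∉ U p).filter fun p => χ₂ ∉ U p) ⊆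
          (((W.filter fun p => gann U W p = ∅).filter fun p => χ₁ ∉ U p).filter fun p => χ₂ ∉ U p) := by
        intro q hq'
        simp only [mem_filter] at hq' ⊢
        exact ⟨⟨hq'.1.1, hP q hq'.1.1.1 hq'.1.1.2 hq'.1.2 hq'.2⟩, hq'.2⟩
      have := h2.trans (card_le_card hsub)
      omega
    · have hcard' : χ₁.ncard + (χ₂ \ {g}).ncard ≤ n := by
        have := Set.ncard_sdiff_singleton_add_one hg (Set.toFinite χ₂); omega
      have h2 := ih hcard' h₁ h₂'
      have hsub : (((W.filter fun p => gann U W p = ∅).filter fun p => χ₁ ∉ U p).filter fun p => χ₂ \ {g} ∉ U p) ⊆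
          (((W.filter fun p => gann U W p = ∅).filter fun p => χ₁ ∉ U p).filter fun p => χ₂ ∉ U p) := by
        intro q hq'
        simp only [mem_filter] at hq' ⊢
        exact ⟨hq'.1, hP q hq'.1.1.1 hq'.1.1.2 hq'.2 hq'.1.2⟩
      have := h2.trans (card_le_card hsub)
      omega

/-- **Cross lemma, packaged**: the number of pure members failing at both annihilator points is at least two. [this work] -/
theorem two_le_card_cross' (hE0 : ∃ f, CoreFree U f) {z₁ z₂ : κ} (hz : z₁ ≠ z₂) {χ₁ χ₂ : Set ι} (h₁ : χ₁ ∈ gann U W z₁)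
    (h₂ : χ₂ ∈ gann U W z₂) :
    2 ≤ ((((W.filter fun p => gann U W p = ∅).filter fun p => χ₁ ∉ U p).filter fun p => χ₂ ∉ U p)).card :=
  G.two_le_card_cross hE0 hz _ le_rfl h₁ h₂

end GluedSetting

end GluedFrames

end Summit.CriticalPhenomena.PercolationContinuityZ3.Theorems
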